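import Summits.BirchSwinnertonDyer.BirchSwinnertonDyer.Theorems.EdixhovenFibreFiveSevenStarredOptimalManinUnitFiveSevenDualExpOuterGaloisInvariant
import Literature.NumberTheory.EllipticCurves.LocalTatePairingOuterGalois
import Literature.NumberTheory.EllipticCurves.ReciprocityLawTowerAssembly
import HarnessLib

/-!
# G5 by GALOIS DESCENT: Kato's formula over a Galois extension `F/F₀` holds with a constant FROM `F₀`
# (route `EdixhovenFibreFiveSeven`, crux K★ `StarredOptimalManinUnitFiveSeven` stmt-BirchSwinnertonDyer-22226, line `kato-lever`)

HONEST FRAMING. Theorems only (no definition, no named fact, no `sorry`, no instance); `--supports` 22226 (helper); nothing is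
closed; BSD / K★ / [REC-tower] are NOT proved by this file.

WHAT. The generic layer of [REC-tower]@cells (`Literature/…/ReciprocityLawTowerAssembly.exists_const_tower_clauses_of_direct`, LEAD g22)
derives BOTH clauses of [REC-tower] `tatePairingPoint_eq_trace_expStar_log_tower` at a tower `F₀ ⊆ F` from ONE input: Kato's formula
`⟨[η], P⟩ = Tr_{F/ℚ_p}(c · exp*_d(η) · log_ω P)` over `F` for the DIRECT representation with a constant OF THE FORM `c = c₀|_F`, `c₀ ∈ F₀`
(«G5, one constant»). This file removes the restriction on the constant when `F/F₀` is GALOIS (the cells: `ℚ_p ⊆ ℚ_p(μ_m)`):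

* ★★ `tatePairingPoint_eq_trace_symm_const` — the formula with constant `c` implies the formula with constant `g⁻¹ c` for every
  `g ∈ Gal(F/F₀)`: evaluate it at `(ĝ·η, g·P)` and use the three equivariances — of the pairing (`LocalTatePairingOuterGalois`,
  [AbsAnab] Prop. 1.2.1 (vii)), of `exp*_d` (`…DualExpOuterGaloisInvariant`, for `d` coming from `F₀` and `exp*_{d₀} ≢ 0`), of `log_ω`
  (`padicLogPointFiniteExt_map_of_val_eq`, automorphisms being isometries) — and `Tr_{F/ℚ_p} ∘ g = Tr_{F/ℚ_p}`.
* ★★★ `tatePairingPoint_eq_trace_of_galois` — AVERAGING over `Gal(F/F₀)`: the formula holds with the constant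
  `[F:F₀]⁻¹ · Tr_{F/F₀}(c) ∈ F₀` (`trace_eq_sum_automorphisms`).
* ★★★ `exists_const_tower_clauses_of_galois` — [REC-tower]'s body `∃ c₀ ≠ 0, (lower) ∧ (upper)` at `(W, F₀ ⊆ F, e, d₀, d)` from Kato's formula
  over `F` with an ARBITRARY constant `c ∈ F` (+ the tower binders, `hcomp`, `hlog`, a nonzero additive
  `E(F₀) → ℤ_p`): `exists_const_tower_clauses_of_direct` fed with the averaged constant.

So [REC-tower]@cell ⟸ Kato's formula over `F₁ = ℚ_p(μ_m)_{w₀}` for the direct representation with ANY constant (⟸ (K₂)@K_v(μ_m) + G1 +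
descent, memo `Cruxes/StarredOptimalManinUnitFiveSeven/Lines/kato-lever-K3-legendre.md` §9.3) + cell plumbing; the «one constant» G5 is no
longer a separate debt. K★ stays OPEN ⟸ {P1-bar, [REC-tower] ⟸ (K₂)}; BSD is not proved by any of this.

## References
* K. Kato, LNM 1553 (1993), Ch. II §1.2.4 (functoriality of `exp*`), Thm. 1.4.1 (4). [Kato1993LNM1553]
* J.-P. Serre, *Local Fields* (1979), XI §2 Prop. 1, XIII §3 (functoriality of `inv`). [SerreLocalFields1979]
* J. Neukirch, *Algebraic Number Theory* (1999), Ch. I §2 (`Tr = Σ σ` for Galois extensions). [NeukirchANT1999]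
-/

set_option autoImplicit false
-- the Theorems namespace of a single-conjunct summit repeats the summit name by design (D-0017)
set_option linter.dupNamespace false

noncomputable section

open scoped Classical NNReal TensorProduct
open CategoryTheory Function Field ValuativeRel
open Literature.NumberTheory.GaloisRepresentations
open Literature.NumberTheory.GaloisRepresentations.IsNonarchimedeanLocalField
open Literature.NumberTheory.PAdicHodge
open Literature.NumberTheory.EllipticCurves _root_.WeierstrassCurve
open Summit.BirchSwinnertonDyer.BirchSwinnertonDyer.Theorems.StarredOptimalManinUnitFiveSevenDualExpOuterGaloisInvariant

namespace Summit.BirchSwinnertonDyer.BirchSwinnertonDyer.Theorems.StarredOptimalManinUnitFiveSevenReciprocityGaloisDescent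

variable {K₀ : Type} [Field K₀] [CharZero K₀] (W : WeierstrassCurve K₀) [W.IsElliptic]
  -- the lower field
  (F₀ : Type) [Field F₀] [Algebra K₀ F₀] [ValuativeRel F₀] [TopologicalSpace F₀] [IsNonarchimedeanLocalField F₀] [CharZero F₀]
  {p : ℕ} [Fact p.Prime] [Fact (¬ IsUnit (p : integerC F₀))] [IsAdicComplete (Ideal.span {(p : integerC F₀)}) (integerC F₀)]
  (hp₀ : valuation F₀ p < 1) [Algebra ℚ_[p] F₀] [FiniteDimensional ℚ_[p] F₀]
  (w₀ : Valuation F₀ ℝ≥0) [(W.baseChange F₀).IsIntegral w₀.integer]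
  -- the upper field
  (F : Type) [Field F] [Algebra K₀ F] [Algebra F₀ F] [IsScalarTower K₀ F₀ F] [ValuativeRel F] [TopologicalSpace F]
  [IsNonarchimedeanLocalField F] [CharZero F] [Fact (¬ IsUnit (p : integerC F))]
  [IsAdicComplete (Ideal.span {(p : integerC F)}) (integerC F)]
  (hp : valuation F p < 1) [Algebra ℚ_[p] F] [IsScalarTower ℚ_[p] F₀ F] [FiniteDimensional F₀ F]
  (w : Valuation F ℝ≥0) [w.Compatible] [(W.baseChange F).IsIntegral w.integer]
  -- the Weil tower
  (e : (k : ℕ) → geomTorsion W ((p ^ k : ℕ) : ℤ) → geomTorsion W ((p ^ k : ℕ) : ℤ) → AlgebraicClosure K₀)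
  (hμ : ∀ k S T, e k S T ^ (p ^ k) = 1) (hadd₁ : ∀ k S₁ S₂ T, e k (S₁ + S₂) T = e k S₁ T * e k S₂ T)
  (hadd₂ : ∀ k S T₁ T₂, e k S (T₁ + T₂) = e k S T₁ * e k S T₂)
  (hgal : ∀ k (σ : absoluteGaloisGroup K₀) (S T : geomTorsion W ((p ^ k : ℕ) : ℤ)), σ • e k S T = e k (σ • S) (σ • T))
  (hcompat : ∀ k (S T : geomTorsion W ((p ^ (k + 1) : ℕ) : ℤ)),
    e k (torsionMulHom W (p ^ (k + 1)) (p ^ k) p (pow_succ p k).symm S)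
      (torsionMulHom W (p ^ (k + 1)) (p ^ k) p (pow_succ p k).symm T) = e (k + 1) S T ^ p)
  -- the intertwiner `V(γ⁻¹)`
  {gV : W.rationalTateModule p ≃ₗ[ℚ_[p]] W.rationalTateModule p}
  (hgVdef : ∀ m, gV m = (W.rationalTateGaloisRep p (W.continuous_rationalGaloisRepTate_holds p)) (towerConjElement K₀ F₀ F)⁻¹ m)

/-! ### §1 Small inputs: `log_ω` and `Tr_{F/ℚ_p}` under an automorphism of `F` -/

omit [CharZero K₀] [Fact (¬ IsUnit (p : integerC F))] [IsAdicComplete (Ideal.span {(p : integerC F)}) (integerC F)] [Algebra ℚ_[p] F]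
  [Algebra F₀ F] [IsScalarTower K₀ F₀ F] in
include hp in
/-- **`log_ω(g·P) = g(log_ω P)`** for an automorphism `g` of the `p`-adic field `F` over `K₀` (automorphisms preserve the valuation,
`BdROuterGalois.valuation_algEquiv_eq`; the tree's `padicLogPointFiniteExt_map_of_val_eq`). [cite: SilvermanAEC2009, Thm. IV.6.4 with Prop. VII.2.2] -/
theorem padicLogPointFiniteExt_map_algEquiv (g : F ≃ₐ[K₀] F) (P : (W.baseChange F).toAffine.Point) :
    FormalGroupChart.padicLogPointFiniteExt w (W.baseChange F) p (WeierstrassCurve.Affine.Point.map (g : F →ₐ[K₀] F) P) =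
      g (FormalGroupChart.padicLogPointFiniteExt w (W.baseChange F) p P) := by
  have hp0 : (p : F) ≠ 0 := Nat.cast_ne_zero.mpr (Fact.out : p.Prime).ne_zero
  have hval : ∀ x : F, valuation F (g x) = valuation F x := fun x => valuation_algEquiv_eq (ℓ := p) hp g x
  have hw : ∀ x : F, w (g x) = w x := fun x =>
    (Valuation.veq_iff_eq w).mp ((Valuation.veq_iff_eq (valuation F)).mpr (hval x))
  have hwp : w (p : F) < 1 := (Valuation.vlt_one_iff w).mp ((Valuation.vlt_one_iff (valuation F)).mpr hp)
  obtain ⟨m, hm, hmP⟩ := FormalGroupChart.exists_nsmul_mem_level_of_isNonarchimedeanLocalField (W.baseChange F) w hp0 P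
  exact FormalGroupChart.padicLogPointFiniteExt_map_of_val_eq (X := W) hp0 hwp
    (FormalGroupChart.limitLog_spec_of_isNonarchimedeanLocalField (W.baseChange F) w hp0 hp)
    (FormalGroupChart.limitLog_spec_of_isNonarchimedeanLocalField (W.baseChange F) w hp0 hp)
    (ι := (g : F →ₐ[K₀] F)) (fun x => hw x) hm hmP

omit [CharZero K₀] [Fact (¬ IsUnit (p : integerC F))] [IsAdicComplete (Ideal.span {(p : integerC F)}) (integerC F)]
  [Algebra F₀ F] [IsScalarTower K₀ F₀ F] [ValuativeRel F] [TopologicalSpace F] [IsNonarchimedeanLocalField F] in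
/-- **`Tr_{F/ℚ_p}(g y) = Tr_{F/ℚ_p}(y)`**: an automorphism of `F` is `ℚ_p`-linear (rigidity of `ℚ_p → F`, `LocalField.ringHom_padic_ext` — here
for the given `ℚ_p`-structure) and the trace is invariant under algebra automorphisms. [cite: NeukirchANT1999, Ch. I §2] -/
theorem trace_algEquiv [ValuativeRel F] [TopologicalSpace F] [IsNonarchimedeanLocalField F] (g : F ≃ₐ[K₀] F) (y : F) :
    Algebra.trace ℚ_[p] F (g y) = Algebra.trace ℚ_[p] F y := by
  have hgp : ∀ q : ℚ_[p], g (algebraMap ℚ_[p] F q) = algebraMap ℚ_[p] F q := fun q =>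
    RingHom.congr_fun (LocalField.ringHom_padic_ext ((g : F →+* F).comp (algebraMap ℚ_[p] F)) (algebraMap ℚ_[p] F)) q
  exact Algebra.trace_eq_of_algEquiv (AlgEquiv.ofRingEquiv (f := g.toRingEquiv) hgp) y

/-! ### §2 The formula with constant `c` gives the formula with constant `g⁻¹ c` -/

omit [FiniteDimensional ℚ_[p] F₀] [IsScalarTower ℚ_[p] F₀ F] in
include hgal hgVdef in
/-- ★★ **Kato's formula is `Gal(F/F₀)`-equivariant.** If `⟨[η], P⟩ = Tr_{F/ℚ_p}(c · exp*_{d'}(η) · log_ω P)` for all `η ∈ Z¹(Γ_F, T_pW|)`,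
`P ∈ E(F)` (`d' = d.map V(γ⁻¹)` the direct-representation reading of a tower generator `d` compatible with `d₀` over `F₀`, and SOME `η₀` over
`F₀` has `exp*_{d₀}(η₀) ≠ 0`), then the same holds with `c` replaced by `g⁻¹ c` for every `g ∈ Aut(F/F₀)`: evaluate at `(ĝ·η, g·P)` for a lift
`ĝ` of `g` and use `⟨ĝ·η, g·P⟩ = ⟨η, P⟩`, `exp*_{d'}(ĝ·η) = g(exp*_{d'} η)`, `log_ω(g·P) = g(log_ω P)`, `Tr ∘ g = Tr`.
[cite: Kato1993LNM1553, Ch. II §1.2.4 and Thm. 1.4.1 (4)] [cite: SerreLocalFields1979, XI §2 Prop. 1 and XIII §3] -/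
theorem tatePairingPoint_eq_trace_symm_const
    (hinj : (bdRPeriodRingData (F := F) (p := p) hp).CupLogInjective (logCyclotomic p)
      ((restrictedRationalTateRep W F₀ p).restrict (absGaloisRestrict F₀ F)))
    (hde : ∀ z : contOneCocycles ((restrictedRationalTateRep W F₀ p).restrict (absGaloisRestrict F₀ F)).toTopRep,
      (bdRPeriodRingData (F := F) (p := p) hp).HasDualExp (logCyclotomic p)
        ((restrictedRationalTateRep W F₀ p).restrict (absGaloisRestrict F₀ F)) fun σ => z.1 σ)
    (d₀ : (bdRPeriodRingData (F := F₀) (p := p) hp₀).FilZeroLine (restrictedRationalTateRep W F₀ p))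
    (d : (bdRPeriodRingData (F := F) (p := p) hp).FilZeroLine ((restrictedRationalTateRep W F₀ p).restrict (absGaloisRestrict F₀ F)))
    (hcomp : ∀ (η₀ : contOneCocycles (restrictedTateRep W F₀ p).toTopRep)
        (η : contOneCocycles ((restrictedTateRep W F₀ p).restrict (absGaloisRestrict F₀ F)).toTopRep),
        (∀ σ, η.1 σ = η₀.1 (absGaloisRestrict F₀ F σ)) →
        expStarCoordTower W hp d η = algebraMap F₀ F (expStarCoord W hp₀ d₀ η₀))
    (hne : ∃ η₀ : contOneCocycles (restrictedTateRep W F₀ p).toTopRep, expStarCoord W hp₀ d₀ η₀ ≠ 0)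
    (c : F)
    (hrec : ∀ (η' : contOneCocycles (restrictedTateRep W F p).toTopRep) (P : (W.baseChange F).toAffine.Point),
      ((tatePairingPoint W F p e hμ hadd₁ hadd₂ hgal hcompat (oneCocycleClass _ η') P : ℤ_[p]) : ℚ_[p]) =
        Algebra.trace ℚ_[p] F
          (c * expStarCoord W hp
              (d.map gV (ratGalEquiv_intertwines W F₀ (absGaloisRestrict_eq_conj_towerConjElement_inv F₀ F) hgVdef)) η' *
            FormalGroupChart.padicLogPointFiniteExt w (W.baseChange F) p P))
    (g : F ≃ₐ[F₀] F)
    (η' : contOneCocycles (restrictedTateRep W F p).toTopRep) (P : (W.baseChange F).toAffine.Point) :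
    ((tatePairingPoint W F p e hμ hadd₁ hadd₂ hgal hcompat (oneCocycleClass _ η') P : ℤ_[p]) : ℚ_[p]) =
      Algebra.trace ℚ_[p] F
        (g.symm c * expStarCoord W hp
            (d.map gV (ratGalEquiv_intertwines W F₀ (absGaloisRestrict_eq_conj_towerConjElement_inv F₀ F) hgVdef)) η' *
          FormalGroupChart.padicLogPointFiniteExt w (W.baseChange F) p P) := by
  haveI : Algebra.IsAlgebraic F₀ F := Algebra.IsAlgebraic.of_finite F₀ F
  -- the outer datum of `g`
  obtain ⟨ĝ, hĝ, γ₀, hγ₀⟩ := exists_algEquiv_lift_inner (K₀ := K₀) F₀ F g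
  let g' : F ≃ₐ[K₀] F := g.restrictScalars K₀
  have hĝ' : ∀ x : F, ĝ (algebraMap F (AlgebraicClosure F) x) = algebraMap F (AlgebraicClosure F) (g' x) := hĝ
  obtain ⟨α, hα⟩ := exists_continuousMulEquiv_outerConj F ĝ g' hĝ'
  obtain ⟨τ, hτ⟩ := exists_outerEmb F ĝ
  have hconj := absGaloisRestrict_eq_conj_of_outer F ĝ hα hτ
  obtain ⟨gτ, hgτ⟩ := exists_ratGalEquiv W (p := p) τ
  have hval : ∀ x : F, valuation F (g' x) = valuation F x := fun x => valuation_algEquiv_eq (ℓ := p) hp g' x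
  -- the tower datum
  have hconj₀ := absGaloisRestrict_eq_conj_towerConjElement_inv (K₀ := K₀) F₀ F
  have hτ₀ := absClosureEmbedding_tower_eq_towerConjElement_inv_smul K₀ F₀ F
  have hinjF := cupLogInjective_res_of_tower W F₀ hp hconj₀ hgVdef hinj
  have hdeF := hasDualExp_direct_of_tower W F₀ hp hgVdef hde
  have hcomp' := expStarCoord_map_res_eq_algebraMap W F₀ hp hconj₀ hgVdef hp₀ hinj hde d₀ d hcomp
  -- the conjugated cocycle `ĝ·η` and the moved point `g·P`
  have h := hrec
    (contOneCocycles.pullback (α.symm : absoluteGaloisGroup F →ₜ* absoluteGaloisGroup F)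
      ((W.tateGaloisRep p (W.continuous_galoisRepTate_holds p)).toIntRep.restrictConjHom
        ((absGaloisRestrict K₀ F).comp (α.symm : absoluteGaloisGroup F →ₜ* absoluteGaloisGroup F))
        (absGaloisRestrict K₀ F) τ hconj) η')
    (WeierstrassCurve.Affine.Point.map (g' : F →ₐ[K₀] F) P)
  -- the three equivariances
  rw [← map_oneCocycleClass, tatePairingPoint_outerConj_map W F p e hμ hadd₁ hadd₂ hgal hcompat ĝ g' hĝ' hval hα hτ hconj,
    expStarCoord_outerConj W F₀ F p hp hp₀ g' ĝ hĝ' hα hτ hconj hgτ hγ₀ hτ₀ hconj₀ hinjF hdeF d₀ _ hcomp' hne,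
    padicLogPointFiniteExt_map_algEquiv W F hp w g' P] at h
  rw [h]
  have hx : g' (g.symm c * expStarCoord W hp
        (d.map gV (ratGalEquiv_intertwines W F₀ (absGaloisRestrict_eq_conj_towerConjElement_inv F₀ F) hgVdef)) η' *
      FormalGroupChart.padicLogPointFiniteExt w (W.baseChange F) p P) =
      c * g' (expStarCoord W hp
        (d.map gV (ratGalEquiv_intertwines W F₀ (absGaloisRestrict_eq_conj_towerConjElement_inv F₀ F) hgVdef)) η') *
      g' (FormalGroupChart.padicLogPointFiniteExt w (W.baseChange F) p P) := by
    rw [map_mul, map_mul]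
    exact congrArg (fun y => y * _ * _) (g.apply_symm_apply c)
  rw [← hx, trace_algEquiv (K₀ := K₀) F (p := p) g']

/-! ### §3 Averaging over `Gal(F/F₀)` -/

omit [FiniteDimensional ℚ_[p] F₀] [IsScalarTower ℚ_[p] F₀ F] in
include hgal hgVdef in
/-- ★★★ **Kato's formula over a Galois `F/F₀` holds with the constant `[F:F₀]⁻¹ · Tr_{F/F₀}(c) ∈ F₀`** (sum the formulas with constants
`g⁻¹ c`, `g ∈ Gal(F/F₀)`, of `tatePairingPoint_eq_trace_symm_const`; `Σ_g g c = Tr_{F/F₀}(c)|_F`, `|Gal(F/F₀)| = [F:F₀]`).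
[cite: Kato1993LNM1553, Ch. II §1.2.4 and Thm. 1.4.1 (4)] [cite: NeukirchANT1999, Ch. I §2] -/
theorem tatePairingPoint_eq_trace_of_galois [IsGalois F₀ F]
    (hinj : (bdRPeriodRingData (F := F) (p := p) hp).CupLogInjective (logCyclotomic p)
      ((restrictedRationalTateRep W F₀ p).restrict (absGaloisRestrict F₀ F)))
    (hde : ∀ z : contOneCocycles ((restrictedRationalTateRep W F₀ p).restrict (absGaloisRestrict F₀ F)).toTopRep,
      (bdRPeriodRingData (F := F) (p := p) hp).HasDualExp (logCyclotomic p)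
        ((restrictedRationalTateRep W F₀ p).restrict (absGaloisRestrict F₀ F)) fun σ => z.1 σ)
    (d₀ : (bdRPeriodRingData (F := F₀) (p := p) hp₀).FilZeroLine (restrictedRationalTateRep W F₀ p))
    (d : (bdRPeriodRingData (F := F) (p := p) hp).FilZeroLine ((restrictedRationalTateRep W F₀ p).restrict (absGaloisRestrict F₀ F)))
    (hcomp : ∀ (η₀ : contOneCocycles (restrictedTateRep W F₀ p).toTopRep)
        (η : contOneCocycles ((restrictedTateRep W F₀ p).restrict (absGaloisRestrict F₀ F)).toTopRep),
        (∀ σ, η.1 σ = η₀.1 (absGaloisRestrict F₀ F σ)) →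
        expStarCoordTower W hp d η = algebraMap F₀ F (expStarCoord W hp₀ d₀ η₀))
    (hne : ∃ η₀ : contOneCocycles (restrictedTateRep W F₀ p).toTopRep, expStarCoord W hp₀ d₀ η₀ ≠ 0)
    (c : F)
    (hrec : ∀ (η' : contOneCocycles (restrictedTateRep W F p).toTopRep) (P : (W.baseChange F).toAffine.Point),
      ((tatePairingPoint W F p e hμ hadd₁ hadd₂ hgal hcompat (oneCocycleClass _ η') P : ℤ_[p]) : ℚ_[p]) =
        Algebra.trace ℚ_[p] F
          (c * expStarCoord W hp
              (d.map gV (ratGalEquiv_intertwines W F₀ (absGaloisRestrict_eq_conj_towerConjElement_inv F₀ F) hgVdef)) η' *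
            FormalGroupChart.padicLogPointFiniteExt w (W.baseChange F) p P))
    (η' : contOneCocycles (restrictedTateRep W F p).toTopRep) (P : (W.baseChange F).toAffine.Point) :
    ((tatePairingPoint W F p e hμ hadd₁ hadd₂ hgal hcompat (oneCocycleClass _ η') P : ℤ_[p]) : ℚ_[p]) =
      Algebra.trace ℚ_[p] F
        (algebraMap F₀ F ((Module.finrank F₀ F : F₀)⁻¹ * Algebra.trace F₀ F c) * expStarCoord W hp
            (d.map gV (ratGalEquiv_intertwines W F₀ (absGaloisRestrict_eq_conj_towerConjElement_inv F₀ F) hgVdef)) η' *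
          FormalGroupChart.padicLogPointFiniteExt w (W.baseChange F) p P) := by
  letI : Fintype (F ≃ₐ[F₀] F) := AlgEquiv.fintype F₀ F
  set X := expStarCoord W hp
      (d.map gV (ratGalEquiv_intertwines W F₀ (absGaloisRestrict_eq_conj_towerConjElement_inv F₀ F) hgVdef)) η' *
    FormalGroupChart.padicLogPointFiniteExt w (W.baseChange F) p P with hX
  set A := ((tatePairingPoint W F p e hμ hadd₁ hadd₂ hgal hcompat (oneCocycleClass _ η') P : ℤ_[p]) : ℚ_[p]) with hA
  have hg : ∀ g : F ≃ₐ[F₀] F, A = Algebra.trace ℚ_[p] F (g.symm c * X) := fun g => by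
    have h := tatePairingPoint_eq_trace_symm_const W F₀ hp₀ F hp w e hμ hadd₁ hadd₂ hgal hcompat hgVdef hinj hde d₀ d hcomp hne c hrec g η' P
    rw [hA, h, mul_assoc, hX]
  -- sum over the Galois group
  have hn : (Fintype.card (F ≃ₐ[F₀] F) : ℚ_[p]) ≠ 0 := Nat.cast_ne_zero.mpr Fintype.card_ne_zero
  have hsum : (Fintype.card (F ≃ₐ[F₀] F) : ℚ_[p]) * A = Algebra.trace ℚ_[p] F (algebraMap F₀ F (Algebra.trace F₀ F c) * X) := by
    rw [← nsmul_eq_mul, ← Finset.card_univ, ← Finset.sum_const, Finset.sum_congr rfl fun g _ => hg g, ← map_sum,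
      ← Finset.sum_mul, trace_eq_sum_automorphisms,
      ← Fintype.sum_bijective _ AlgEquiv.symm_bijective (fun g : F ≃ₐ[F₀] F => g.symm c) (fun g => g c) fun _ => rfl]
  have hcard : (Fintype.card (F ≃ₐ[F₀] F) : ℚ_[p]) = (Module.finrank F₀ F : ℚ_[p]) := by
    rw [← Nat.card_eq_fintype_card, IsGalois.card_aut_eq_finrank]
  -- divide by `[F:F₀]`
  have hfin : (Module.finrank F₀ F : ℚ_[p]) ≠ 0 := hcard ▸ hn
  rw [mul_assoc, ← hX]
  calc A = (Module.finrank F₀ F : ℚ_[p])⁻¹ * ((Module.finrank F₀ F : ℚ_[p]) * A) := by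
        rw [← mul_assoc, inv_mul_cancel₀ hfin, one_mul]
    _ = (Module.finrank F₀ F : ℚ_[p])⁻¹ * Algebra.trace ℚ_[p] F (algebraMap F₀ F (Algebra.trace F₀ F c) * X) := by
        rw [← hcard, hsum]
    _ = Algebra.trace ℚ_[p] F (algebraMap F₀ F ((Module.finrank F₀ F : F₀)⁻¹ * Algebra.trace F₀ F c) * X) := by
        have hR : algebraMap F₀ F ((Module.finrank F₀ F : F₀)⁻¹ * Algebra.trace F₀ F c) * X =
            ((Module.finrank F₀ F : ℚ_[p]))⁻¹ • (algebraMap F₀ F (Algebra.trace F₀ F c) * X) := by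
          rw [map_mul (algebraMap F₀ F), map_inv₀ (algebraMap F₀ F), map_natCast (algebraMap F₀ F), Algebra.smul_def,
            map_inv₀ (algebraMap ℚ_[p] F), map_natCast (algebraMap ℚ_[p] F), mul_assoc]
        rw [hR, LinearMap.map_smul, smul_eq_mul]

/-! ### §4 [REC-tower]'s body from Kato's formula over `F` with an arbitrary constant -/

include hgal hgVdef in
/-- ★★★ **The body of [REC-tower] at `(W, F₀ ⊆ F, e, d₀, d)` — `∃ c ≠ 0, (lower clause) ∧ (upper clause)` — from Kato's formula over the
GALOIS extension `F/F₀` for the direct representation with an ARBITRARY constant `c ∈ F`** (plus the Prop-1.2.3 binders of the tower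
representation, the compatibility clause `hcomp`, the functoriality `hlog` of `log_ω`, one `η₀` with `exp*_{d₀}(η₀) ≠ 0`, and a nonzero additive
`E(F₀) → ℤ_p` for `c₀ ≠ 0`): `exists_const_tower_clauses_of_direct` fed with the averaged constant of `tatePairingPoint_eq_trace_of_galois`.
This discharges the «one constant» item G5 of [REC-tower]@cells. [cite: Kato1993LNM1553, Ch. II §1.2.4 and Thm. 1.4.1 (4)] [cite: SerreLocalFields1979, XIII §3 Prop. 7] -/
theorem exists_const_tower_clauses_of_galois [IsGalois F₀ F]
    (hnondeg : ∀ k (T : geomTorsion W ((p ^ k : ℕ) : ℤ)), (∀ S, e k S T = 1) → T = 0)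
    (hinj : (bdRPeriodRingData (F := F) (p := p) hp).CupLogInjective (logCyclotomic p)
      ((restrictedRationalTateRep W F₀ p).restrict (absGaloisRestrict F₀ F)))
    (hde : ∀ z : contOneCocycles ((restrictedRationalTateRep W F₀ p).restrict (absGaloisRestrict F₀ F)).toTopRep,
      (bdRPeriodRingData (F := F) (p := p) hp).HasDualExp (logCyclotomic p)
        ((restrictedRationalTateRep W F₀ p).restrict (absGaloisRestrict F₀ F)) fun σ => z.1 σ)
    (d₀ : (bdRPeriodRingData (F := F₀) (p := p) hp₀).FilZeroLine (restrictedRationalTateRep W F₀ p))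
    (d : (bdRPeriodRingData (F := F) (p := p) hp).FilZeroLine ((restrictedRationalTateRep W F₀ p).restrict (absGaloisRestrict F₀ F)))
    (hcomp : ∀ (η₀ : contOneCocycles (restrictedTateRep W F₀ p).toTopRep)
        (η : contOneCocycles ((restrictedTateRep W F₀ p).restrict (absGaloisRestrict F₀ F)).toTopRep),
        (∀ σ, η.1 σ = η₀.1 (absGaloisRestrict F₀ F σ)) →
        expStarCoordTower W hp d η = algebraMap F₀ F (expStarCoord W hp₀ d₀ η₀))
    (hlog : ∀ P₀ : (W.baseChange F₀).toAffine.Point,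
      FormalGroupChart.padicLogPointFiniteExt w (W.baseChange F) p
          (WeierstrassCurve.Affine.Point.map (IsScalarTower.toAlgHom K₀ F₀ F) P₀) =
        algebraMap F₀ F (FormalGroupChart.padicLogPointFiniteExt w₀ (W.baseChange F₀) p P₀))
    (c : F)
    (hrec : ∀ (η' : contOneCocycles (restrictedTateRep W F p).toTopRep) (P : (W.baseChange F).toAffine.Point),
      ((tatePairingPoint W F p e hμ hadd₁ hadd₂ hgal hcompat (oneCocycleClass _ η') P : ℤ_[p]) : ℚ_[p]) =
        Algebra.trace ℚ_[p] F
          (c * expStarCoord W hp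
              (d.map gV (ratGalEquiv_intertwines W F₀ (absGaloisRestrict_eq_conj_towerConjElement_inv F₀ F) hgVdef)) η' *
            FormalGroupChart.padicLogPointFiniteExt w (W.baseChange F) p P))
    (hφ : ∃ φ : (W.baseChange F₀).toAffine.Point →+ ℤ_[p], φ ≠ 0) :
    ∃ c₀ : F₀, c₀ ≠ 0 ∧
      (∀ (η₀ : contOneCocycles (restrictedTateRep W F₀ p).toTopRep) (P₀ : (W.baseChange F₀).toAffine.Point),
        ((tatePairingPoint W F₀ p e hμ hadd₁ hadd₂ hgal hcompat (oneCocycleClass _ η₀) P₀ : ℤ_[p]) : ℚ_[p]) =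
          Algebra.trace ℚ_[p] F₀
            (c₀ * expStarCoord W hp₀ d₀ η₀ * FormalGroupChart.padicLogPointFiniteExt w₀ (W.baseChange F₀) p P₀)) ∧
      ∀ (η : contOneCocycles ((restrictedTateRep W F₀ p).restrict (absGaloisRestrict F₀ F)).toTopRep)
        (P : (W.baseChange F).toAffine.Point),
        ((tatePairingPointTower W F₀ e hμ hadd₁ hadd₂ hgal hcompat (oneCocycleClass _ η) P : ℤ_[p]) : ℚ_[p]) =
          Algebra.trace ℚ_[p] F
            (algebraMap F₀ F c₀ * expStarCoordTower W hp d η * FormalGroupChart.padicLogPointFiniteExt w (W.baseChange F) p P) := by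
  -- `exp*_{d₀} ≢ 0`: otherwise the lower formula (descent of `hrec`, any constant) makes `⟨[η₀], ·⟩ ≡ 0`, contradicting [TD] and `hφ`
  have hne : ∃ η₀ : contOneCocycles (restrictedTateRep W F₀ p).toTopRep, expStarCoord W hp₀ d₀ η₀ ≠ 0 := by
    by_contra hall
    have hall' : ∀ η₀ : contOneCocycles (restrictedTateRep W F₀ p).toTopRep, expStarCoord W hp₀ d₀ η₀ = 0 :=
      fun η₀ => by_contra fun h => hall ⟨η₀, h⟩
    have hlow := tatePairingPoint_eq_trace_of_direct_towerConj W F₀ hp₀ w₀ F hp w e hμ hadd₁ hadd₂ hgal hcompat hgVdef hinj hde d₀ d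
      hcomp hlog c hrec
    exact ne_zero_of_tatePairingPoint_eq_trace W F₀ w₀ e hμ hadd₁ hadd₂ hgal hcompat hnondeg (fun _ => (1 : F₀)) 0
      (fun η₀ P₀ => by rw [hlow η₀ P₀, hall' η₀, mul_zero, zero_mul, mul_one, zero_mul]) hφ rfl
  exact exists_const_tower_clauses_of_direct W F₀ hp₀ w₀ F hp w e hμ hadd₁ hadd₂ hgal hcompat hgVdef hnondeg hinj hde d₀ d hcomp hlog
    ((Module.finrank F₀ F : F₀)⁻¹ * Algebra.trace F₀ F c)
    (tatePairingPoint_eq_trace_of_galois W F₀ hp₀ F hp w e hμ hadd₁ hadd₂ hgal hcompat hgVdef hinj hde d₀ d hcomp hne c hrec) hφ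

end Summit.BirchSwinnertonDyer.BirchSwinnertonDyer.Theorems.StarredOptimalManinUnitFiveSevenReciprocityGaloisDescent

end
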